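import Mathlib

/-!
# One-lattice moment-blind towers — definitions (data of the construction) and basic positivity

HONEST LABEL.  Negative-side helper toward `¬ IntegerScrew.TwoPrimeFoldRigidity` (item stmt-RiemannHypothesis-25784);
record-negative programme; 0 toward RH.  RH is not proved, not used, not mentioned below.
Nothing here bears on the truth of RH.

No `Prop`-valued definitions: everything below is concrete data of ONE explicit construction (cubed gons, tower
parameters, the level solve, the recursion for the amplitudes, the index type / exponents / weights), plus the
positivity of the integer parameters.  The theorems are in `MBTCubedGon`, `MBTLevels`, `MBTSolve`,
`MBTConditioning`, `MBTBudget`, and the existence theorem `momentBlindTower_exists` in `MomentBlindTower`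
(consumed by `TensorReduction.twoPrimeFoldRigidity_false_of_towers` to refute `IntegerScrew.TwoPrimeFoldRigidity`).

OVERVIEW.  A *cubed gon* of order `n` at base point `σ + iγ` is the family of `n³` atoms `σ + i(γ + β(j₁+j₂+j₃))`,
`β = 2π/(nh)`: at time `kh`, `n ∤ k`, its moment sums of orders `0,1,2` vanish; at `k = j'n` they are
`e^{(σ+iγ)t} n³ W_r`.  Level `m` of the tower has order `n_m = K₀(m+1)`, abscissa `σ_m = A − 20/(n_m h)` and eleven
gons (`G = Fin 5 ⊕ Fin 5 ⊕ Unit`: two quintuples with own-time phases `(-1)^N`, `(-1)^N i`, one forcing gon with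
phase `1`).  `solve m τ` gives amplitudes reproducing a target moment vector `τ` at the own time (six real unknowns
plus the null shift `(S+f)(1,4,6,4,1)` for positivity); `amp` solves the levels in order against the spill `R` of the
earlier dividing levels; `Idx`, `kap`, `wt` assemble the tower (weights `amp·e^{20}/n³`).
-/

set_option linter.dupNamespace false

noncomputable section

open scoped ComplexConjugate
open Complex Finset

namespace Summit.RiemannHypothesis.RiemannHypothesis.Theorems.TwoPrimeFoldRigidity.Negative.MBT

/-- coordinate sum of a triple index. -/
def tsumIdx {n : ℕ} (j : Fin n × Fin n × Fin n) : ℕ := (j.1 : ℕ) + (j.2.1 : ℕ) + (j.2.2 : ℕ)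

/-- power sums `Z_e(ω) = Σ_{j<n} j^e ω^j`. -/
def Zs (n e : ℕ) (ω : ℂ) : ℂ := ∑ j : Fin n, ((j : ℕ) : ℂ) ^ e * ω ^ (j : ℕ)

/-- the atoms of a cubed gon of order `n`: `σ + (γ + β(j₁+j₂+j₃)) i`. -/
def atom (σ β γ : ℝ) {n : ℕ} (j : Fin n × Fin n × Fin n) : ℂ :=
  (σ : ℂ) + ((γ : ℂ) + (β : ℂ) * ((tsumIdx j : ℕ) : ℂ)) * I

/-- normalised conjugate moments of a cubed gon: `W_r = n⁻³ Σ_j conj(atom_j)^r`. -/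
def Wm (n : ℕ) (σ β γ : ℝ) (r : ℕ) : ℂ :=
  (∑ j : Fin n × Fin n × Fin n, conj (atom σ β γ j) ^ r) / ((n : ℂ) ^ 3)

/-- parameters of a one-lattice tower: lattice step `h > 0`, target abscissa `A ∈ (0, 1]`. -/
structure Prm where
  /-- lattice step -/
  h : ℝ
  /-- target abscissa (the unattained supremum of `Re κ`) -/
  A : ℝ
  hh : 0 < h
  hA : 0 < A
  hA1 : A ≤ 1

/-- gon labels of one level: real quintuple `inl N`, imaginary quintuple `inr (inl N)`, forcing gon `inr (inr ())`. -/
abbrev G := Fin 5 ⊕ (Fin 5 ⊕ Unit)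

namespace Prm

variable (p : Prm)

/-- log-depth `L = 20`: a level sits `e^{-L}` below the target line at its own time. -/
def L : ℝ := 20

/-- base order `K₀` (so that `L/(K₀ h) ≤ A/2`). -/
def K₀ : ℕ := ⌈40 / (p.h * p.A)⌉₊ + 1

/-- height unit multiplier `P₀ > h` (so that base heights exceed `1`). -/
def P₀ : ℕ := ⌈p.h⌉₊ + 1

/-- order of level `m`: `n_m = K₀ (m+1)` (every multiple of `K₀`). -/
def nn (m : ℕ) : ℕ := p.K₀ * (m + 1)

/-- abscissa of level `m`: `σ_m = A − L/(n_m h)`. -/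
def σ (m : ℕ) : ℝ := p.A - 20 / ((p.nn m : ℝ) * p.h)

/-- fine height step of level `m`: `β_m = 2π/(n_m h)`. -/
def β (m : ℕ) : ℝ := 2 * Real.pi / ((p.nn m : ℝ) * p.h)

/-- base height of level `m`: `Γ_m = 2π n_m P₀ / h`. -/
def Γ (m : ℕ) : ℝ := 2 * Real.pi * (p.nn m : ℝ) * (p.P₀ : ℝ) / p.h

/-- quintuple spacing of level `m`: `η_m = π(2 n_m² P₀ + 1)/(n_m h) = Γ_m + π/(n_m h)`. -/
def η (m : ℕ) : ℝ := Real.pi * (2 * (p.nn m : ℝ) ^ 2 * (p.P₀ : ℝ) + 1) / ((p.nn m : ℝ) * p.h)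

/-- quarter-phase offset of level `m`: `θ_m = π/(2 n_m h)`. -/
def θ (m : ℕ) : ℝ := Real.pi / (2 * (p.nn m : ℝ) * p.h)

/-- integer phase data: height of gon `g` of level `m` is `π Q / (2 n_m h)`, own-time phase `i^Q`. -/
def Qn (m : ℕ) : G → ℕ
  | Sum.inl N => 4 * (p.nn m) ^ 2 * p.P₀ + 2 * (N : ℕ) * (2 * (p.nn m) ^ 2 * p.P₀ + 1)
  | Sum.inr (Sum.inl N) => 4 * (p.nn m) ^ 2 * p.P₀ + 2 * (N : ℕ) * (2 * (p.nn m) ^ 2 * p.P₀ + 1) + 1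
  | Sum.inr (Sum.inr _) => 4 * (p.nn m) ^ 2 * p.P₀ + 12 * (2 * (p.nn m) ^ 2 * p.P₀ + 1)

/-- base height of gon `g` of level `m`. -/
def γ (m : ℕ) (g : G) : ℝ := Real.pi * (p.Qn m g : ℝ) / (2 * (p.nn m : ℝ) * p.h)

/-- normalised conjugate moments of gon `g` of level `m`. -/
def W (m : ℕ) (g : G) (r : ℕ) : ℂ := Wm (p.nn m) (p.σ m) (p.β m) (p.γ m g) r

/-- `K₀ ≥ 1`. -/
theorem K₀_pos : 0 < p.K₀ := Nat.succ_pos _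

/-- orders are positive. -/
theorem nn_pos (m : ℕ) : 0 < p.nn m := Nat.mul_pos p.K₀_pos (Nat.succ_pos m)

/-- orders are nonzero. -/
theorem nn_ne_zero (m : ℕ) : p.nn m ≠ 0 := (p.nn_pos m).ne'

/-- orders are positive (real form). -/
theorem nn_real_pos (m : ℕ) : (0 : ℝ) < p.nn m := by exact_mod_cast p.nn_pos m

/-- orders are at least `1` (real form). -/
theorem one_le_nn (m : ℕ) : (1 : ℝ) ≤ p.nn m := by exact_mod_cast p.nn_pos m

/-- `P₀ > 0` (real form). -/
theorem P₀_real_pos : (0 : ℝ) < p.P₀ := by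
  have : 0 < p.P₀ := Nat.succ_pos _
  exact_mod_cast this

/-- `h < P₀`. -/
theorem h_lt_P₀ : p.h < p.P₀ := by
  have := Nat.le_ceil p.h
  simp only [P₀]; push_cast; linarith

/-- `1 ≤ P₀` (real form). -/
theorem one_le_P₀ : (1 : ℝ) ≤ p.P₀ := by
  have : 1 ≤ p.P₀ := Nat.succ_pos _
  exact_mod_cast this

/-- own-time phase of gon `g` of level `m`: `i^{Q}`. -/
def φ (m : ℕ) (g : G) : ℂ := I ^ p.Qn m g

/-- forcing amplitude of level `m` (also the positivity slack): `f_m = (m+1)⁻⁴`. -/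
def f (m : ℕ) : ℝ := 1 / ((m : ℝ) + 1) ^ 4

/-- the null vector of the quintuple: binomial row `(1,4,6,4,1)` (fourth differences kill quadratics). -/
def bin4 : Fin 5 → ℝ := ![1, 4, 6, 4, 1]

section Solve

variable (m : ℕ) (τ : ℕ → ℂ)

/-- unknown 1: real-quintuple mass on moment 0. -/
def a1 : ℝ := (τ 0).re

/-- unknown 4: imaginary-quintuple mass on moment 0. -/
def a4 : ℝ := (τ 0).im

/-- first residual after moment 0 is matched. -/
def r1 : ℂ := τ 1 - (a1 τ : ℂ) * p.W m (Sum.inl 0) 1 - (a4 τ : ℂ) * I * p.W m (Sum.inr (Sum.inl 0)) 1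

/-- unknown 2. -/
def a2 : ℝ := (p.r1 m τ).im / p.η m

/-- unknown 5. -/
def a5 : ℝ := -(p.r1 m τ).re / p.η m

/-- second residual after moments 0, 1 are matched. -/
def r2 : ℂ := τ 2 - (a1 τ : ℂ) * p.W m (Sum.inl 0) 2 - (a4 τ : ℂ) * I * p.W m (Sum.inr (Sum.inl 0)) 2
  - (p.a2 m τ : ℂ) * (2 * I * (p.η m : ℂ) * p.W m (Sum.inl 0) 1 + (p.η m : ℂ) ^ 2)
  - (p.a5 m τ : ℂ) * (-2 * (p.η m : ℂ) * p.W m (Sum.inr (Sum.inl 0)) 1 + I * (p.η m : ℂ) ^ 2)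

/-- unknown 3. -/
def a3 : ℝ := (p.r2 m τ).re / (-2 * p.η m ^ 2)

/-- unknown 6. -/
def a6 : ℝ := (p.r2 m τ).im / (-2 * p.η m ^ 2)

/-- raw coefficients of the real quintuple. -/
def cR : Fin 5 → ℝ := ![a1 τ + p.a2 m τ + p.a3 m τ, p.a2 m τ + 2 * p.a3 m τ, p.a3 m τ, 0, 0]

/-- raw coefficients of the imaginary quintuple. -/
def cI : Fin 5 → ℝ := ![a4 τ + p.a5 m τ + p.a6 m τ, p.a5 m τ + 2 * p.a6 m τ, p.a6 m τ, 0, 0]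

/-- `ℓ¹` size of the raw real coefficients. -/
def SR : ℝ := |p.cR m τ 0| + |p.cR m τ 1| + |p.cR m τ 2|

/-- `ℓ¹` size of the raw imaginary coefficients. -/
def SI : ℝ := |p.cI m τ 0| + |p.cI m τ 1| + |p.cI m τ 2|

/-- **the level solve**: amplitudes of the eleven gons of level `m` for the target moment vector `τ`
(raw coefficients shifted by `(S + f)·(1,4,6,4,1)`, which changes no moment and makes every amplitude `≥ f`). -/
def solve : G → ℝ
  | Sum.inl N => p.cR m τ N + (p.SR m τ + f m) * bin4 N
  | Sum.inr (Sum.inl N) => p.cI m τ N + (p.SI m τ + f m) * bin4 N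
  | Sum.inr (Sum.inr _) => f m

/-- weighted size of a moment vector at level `m`: `|v₀| + |v₁|/(15Γ) + |v₂|/(15Γ)²`. -/
def nrm (v : ℕ → ℂ) : ℝ := ‖v 0‖ + ‖v 1‖ / (15 * p.Γ m) + ‖v 2‖ / (15 * p.Γ m) ^ 2

end Solve

/-- spill of (amplitudes `a` of) level `m'` into the `j'`-th multiple of its own time, normalised by `e^{-A t}`:
`Φ_r = Σ_g a_g e^{-L(j'-1)} i^{Q_g j'} W_r(g)`. -/
def Φ (a : G → ℝ) (m' j' : ℕ) (r : ℕ) : ℂ :=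
  ∑ g : G, (a g : ℂ) * (Real.exp (-(20 * ((j' : ℝ) - 1))) : ℝ) * I ^ (p.Qn m' g * j') * p.W m' g r

/-- the earlier levels visible at the own time of level `m`: `m' < m` with `(m'+1) ∣ (m+1)`. -/
def D (m : ℕ) : Finset ℕ := (Finset.range m).filter (fun m' ↦ (m' + 1) ∣ (m + 1))

/-- residual moment vector met by level `m`: the spill of all earlier visible levels. -/
def R (a : ℕ → G → ℝ) (m : ℕ) (r : ℕ) : ℂ := ∑ m' ∈ D m, p.Φ (a m') m' ((m + 1) / (m' + 1)) r

/-- target of level `m`: cancel the residual and the own forcing gon. -/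
def tgt (a : ℕ → G → ℝ) (m : ℕ) (r : ℕ) : ℂ := -p.R a m r - (f m : ℂ) * p.W m (Sum.inr (Sum.inr ())) r

/-- the state after solving levels `0..M` (levels `> M` still zero). -/
def ampSeq : ℕ → ℕ → G → ℝ
  | 0 => fun m ↦ if m = 0 then p.solve 0 (p.tgt (fun _ _ ↦ 0) 0) else fun _ ↦ 0
  | M + 1 => fun m ↦ if m = M + 1 then p.solve (M + 1) (p.tgt (ampSeq M) (M + 1)) else ampSeq M m

/-- **the amplitudes of the tower**: level `m`, gon `g`. -/
def amp (m : ℕ) : G → ℝ := p.ampSeq m m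

/-- total amplitude of level `m`. -/
def E (m : ℕ) : ℝ := ∑ g : G, p.amp m g

/-- positions in the cube of level `m`. -/
abbrev Cube (m : ℕ) := Fin (p.nn m) × Fin (p.nn m) × Fin (p.nn m)

/-- **index type of the tower**: a level, a gon of that level, a position in its cube. -/
abbrev Idx : Type := Σ m : ℕ, G × p.Cube m

/-- exponent of atom `i`. -/
def kap (i : p.Idx) : ℂ := atom (p.σ i.1) (p.β i.1) (p.γ i.1 i.2.1) i.2.2

/-- weight of atom `i`: `amp · e^{L} / n³`. -/
def wt (i : p.Idx) : ℝ := p.amp i.1 i.2.1 * Real.exp 20 / (p.nn i.1 : ℝ) ^ 3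

end Prm

end Summit.RiemannHypothesis.RiemannHypothesis.Theorems.TwoPrimeFoldRigidity.Negative.MBT
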